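import Literature.NumberTheory.LFunctions.DworkRationalityFredholmMatrixAlgebra
import Literature.NumberTheory.LFunctions.DworkRationalityMeromorphy
import HarnessLib

/-!
# Dwork's operator on `R₀`: truncations and `p`-adic estimates (Koblitz, Ch. V §3, pp. 129–131)

Part of the bottom-up proof of Dwork's rationality theorem
(`Literature/NumberTheory/LFunctions/DworkRationality.lean`), towards the named fact
`Dwork.dworkFredholmMatrix` (`…/DworkRationalityFredholm.lean`; Koblitz, GTM 58, Ch. V §3,
Lemma 4). For `G ∈ R₀` (`‖g_w‖ ≤ ρ^{|w|}`, `ρ < 1`) the matrix `A = (g_{qv-u})` of `Ψ = T_q ∘ G`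
has entries `‖A_{v,u}‖ ≤ ρ^{q|v| - |u|}` (Koblitz, p. 130: "`ord_p g_{qσ(u)-u} ≥ M(q|σ(u)| - |u|)`").
This file introduces the finite truncations of the powers of `A` — the chain sums
`Dwork.dworkPowIn N s v u` in which all nodes after the first have degree `≤ N`, i.e. the entries of
the powers of the finite matrix `(A_{v,u})_{|v|,|u| ≤ N}` — and proves the estimates that drive the
passage from finite to infinite matrices in Koblitz's Lemma 4 (cf. §4 Ex. 8):

* `norm_dworkEntry_le`: `‖A_{v,u}‖ ≤ ρ^{q|v| - |u|}`;
* `norm_dworkPow_le`, `norm_dworkPowIn_le`: `‖(Aˢ)_{v,u}‖ ≤ ρ^{q|v| - |u|}` (`s ≥ 1`), and the same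
  for the truncations (a chain `v = w₀ → w₁ → ⋯ → w_s = u` has weight of norm
  `≤ ρ^{∑ (q|wᵢ| - |wᵢ₊₁|)}`);
* `norm_dworkPow_sub_dworkPowIn_le`: for `|u| ≤ N`,
  `‖(Aˢ)_{v,u} - (A_Nˢ)_{v,u}‖ ≤ ρ^{(q-1)(N+1) + q|v| - |u|}` — a chain leaving the degree-`N`
  truncation passes through a node of degree `> N`;
  in particular on the diagonal `‖(Aˢ)_{v,v} - (A_Nˢ)_{v,v}‖ ≤ ρ^{(q-1)(N+1)}`
  (`norm_dworkPow_diag_sub_le`) and `‖(Aˢ)_{v,v}‖ ≤ ρ^{(q-1)|v|}` (`norm_dworkPow_diag_le`).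

Exponents are natural numbers with truncated subtraction; every bound `ρ^{a ∸ b}` with `ρ ≤ 1` is
implied by the real bound `ρ^{a - b}` it abbreviates, and is all that is used downstream.

## References

* N. Koblitz, *p-adic Numbers, p-adic Analysis, and Zeta-Functions*, 2nd ed., GTM 58 (1984),
  Ch. V §3, pp. 129–131 (Lemma 4 and the estimate preceding it). [Koblitz1984]
-/

open Finset MvPowerSeries

noncomputable section

namespace Literature.NumberTheory.LFunctions

namespace Dwork

/-! ### Truncated chain sums -/

section Truncation

variable {ι : Type*} {R : Type*} [CommRing R]

open Classical in
/-- The truncated powers `(A_Nˢ)_{v,u}`: chain sums `∑ A_{v,w₁} A_{w₁,w₂} ⋯ A_{w_{s-1},u}` over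
chains all of whose nodes `w₁, …, w_{s-1}, u` have degree `≤ N` — the entries of the `s`-th power
of the finite matrix `(A_{v,u})_{|v|,|u| ≤ N}` (extended by the same formula to arbitrary `v`).
(Koblitz's finite matrices, Ch. V §3, p. 130.) [cite: Koblitz1984, Ch. V §3] -/
def dworkPowIn (N : ℕ) (q : ℕ) (G : MvPowerSeries ι R) : ℕ → (ι →₀ ℕ) → (ι →₀ ℕ) → R
  | 0, v, u => if v = u then 1 else 0
  | s + 1, v, u => ∑ x ∈ (antidiagonal (q • v)).filter (fun x => Finsupp.degree x.2 ≤ N),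
      coeff x.1 G * dworkPowIn N q G s x.2 u

open Classical in
/-- Unfolding the truncated recursion. [folklore] -/
theorem dworkPowIn_succ (N q : ℕ) (G : MvPowerSeries ι R) (s : ℕ) (v u : ι →₀ ℕ) :
    dworkPowIn N q G (s + 1) v u =
      ∑ x ∈ (antidiagonal (q • v)).filter (fun x => Finsupp.degree x.2 ≤ N),
        coeff x.1 G * dworkPowIn N q G s x.2 u := rfl

open Classical in
/-- `(A_N⁰)_{v,u} = δ_{v,u}`. [folklore] -/
@[simp] theorem dworkPowIn_zero (N q : ℕ) (G : MvPowerSeries ι R) (v u : ι →₀ ℕ) :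
    dworkPowIn N q G 0 v u = if v = u then 1 else 0 := rfl

open Classical in
/-- The truncated chain sums vanish at end points of degree `> N` (for `s ≥ 1`). [folklore] -/
theorem dworkPowIn_eq_zero_of_lt {N q : ℕ} (G : MvPowerSeries ι R) {s : ℕ} (hs : 0 < s)
    (v : ι →₀ ℕ) {u : ι →₀ ℕ} (hu : N < Finsupp.degree u) : dworkPowIn N q G s v u = 0 := by
  induction s generalizing v with
  | zero => exact absurd hs (lt_irrefl 0)
  | succ s ih =>
    rw [dworkPowIn_succ]
    apply Finset.sum_eq_zero
    intro x hx
    rw [mem_filter] at hx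
    rcases Nat.eq_zero_or_pos s with rfl | hs'
    · rw [dworkPowIn_zero, if_neg, mul_zero]
      rintro rfl
      exact absurd hx.2 (not_le.mpr hu)
    · rw [ih hs' x.2, mul_zero]

end Truncation

/-! ### Estimates for `G ∈ R₀` -/

section Estimates

variable {p : ℕ} [Fact p.Prime] {ι : Type*}
variable {G : MvPowerSeries ι ℂ_[p]} {ρ : ℝ} (hρ0 : 0 ≤ ρ) (hρ1 : ρ ≤ 1)
  (hG : ∀ w : ι →₀ ℕ, ‖coeff w G‖ ≤ ρ ^ Finsupp.degree w)

/-- Degrees subtract along `u ≤ a`: `|a - u| = |a| - |u|`. [folklore] -/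
theorem degree_tsub {a u : ι →₀ ℕ} (h : u ≤ a) :
    Finsupp.degree (a - u) = Finsupp.degree a - Finsupp.degree u := by
  have := congrArg Finsupp.degree (tsub_add_cancel_of_le h)
  rw [map_add] at this
  omega

include hρ0 hG in
/-- **`‖A_{v,u}‖ ≤ ρ^{q|v| - |u|}`** (Koblitz, Ch. V §3, p. 130: `ord_p g_{qσ(u)-u} ≥ M(q|σ(u)| - |u|)`). [cite: Koblitz1984, Ch. V §3] -/
theorem norm_dworkEntry_le (q : ℕ) (v u : ι →₀ ℕ) :
    ‖dworkEntry q G v u‖ ≤ ρ ^ (q * Finsupp.degree v - Finsupp.degree u) := by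
  classical
  rw [dworkEntry]
  split_ifs with h
  · refine (hG _).trans (le_of_eq ?_)
    rw [degree_tsub h, map_nsmul, smul_eq_mul]
  · rw [norm_zero]; exact pow_nonneg hρ0 _

include hρ0 hρ1 in
/-- Monotonicity of `ρ^n` in the exponent for `0 ≤ ρ ≤ 1`. [folklore] -/
theorem pow_le_pow_of_le' {m n : ℕ} (h : m ≤ n) : ρ ^ n ≤ ρ ^ m := pow_le_pow_of_le_one hρ0 hρ1 h

include hρ0 hρ1 hG in
open Classical in
/-- The inductive step of the chain estimates: if `‖F(w)‖ ≤ ρ^{(c + q|w|) ∸ |u|}` for all `w` then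
`‖∑_{a + w = qv, w ∈ T} g_a F(w)‖ ≤ ρ^{(c + q|v|) ∸ |u|}` for `q ≥ 1` (ultrametric inequality and
`|a| + (c + q|w| ∸ |u|) ≥ (c + q|v|) ∸ |u|` when `|a| + |w| = q|v|`). [folklore] -/
theorem norm_sum_antidiagonal_le {q : ℕ} (hq : 1 ≤ q) (c : ℕ) (F : (ι →₀ ℕ) → ℂ_[p]) (u v : ι →₀ ℕ)
    (T : Finset ((ι →₀ ℕ) × (ι →₀ ℕ))) (hT : T ⊆ antidiagonal (q • v))
    (hF : ∀ x ∈ T, ‖F x.2‖ ≤ ρ ^ (c + q * Finsupp.degree x.2 - Finsupp.degree u)) :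
    ‖∑ x ∈ T, coeff x.1 G * F x.2‖ ≤ ρ ^ (c + q * Finsupp.degree v - Finsupp.degree u) := by
  refine IsUltrametricDist.norm_sum_le_of_forall_le_of_nonneg (pow_nonneg hρ0 _) fun x hx => ?_
  have hx' := hT hx
  rw [mem_antidiagonal] at hx'
  have hdeg : Finsupp.degree x.1 + Finsupp.degree x.2 = q * Finsupp.degree v := by
    rw [← map_add, hx', map_nsmul, smul_eq_mul]
  rw [norm_mul]
  calc ‖coeff x.1 G‖ * ‖F x.2‖
      ≤ ρ ^ Finsupp.degree x.1 * ρ ^ (c + q * Finsupp.degree x.2 - Finsupp.degree u) :=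
        mul_le_mul (hG _) (hF x hx) (norm_nonneg _) (pow_nonneg hρ0 _)
    _ = ρ ^ (Finsupp.degree x.1 + (c + q * Finsupp.degree x.2 - Finsupp.degree u)) := (pow_add _ _ _).symm
    _ ≤ ρ ^ (c + q * Finsupp.degree v - Finsupp.degree u) := by
        apply pow_le_pow_of_le' hρ0 hρ1
        have h1 : Finsupp.degree x.2 ≤ q * Finsupp.degree x.2 := Nat.le_mul_of_pos_left _ hq
        omega

include hρ0 hρ1 hG in
/-- **`‖(Aˢ)_{v,u}‖ ≤ ρ^{q|v| - |u|}`** for `s ≥ 1`, `q ≥ 1` (each chain `v → w₁ → ⋯ → u` has weight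
of norm `≤ ρ^{∑ᵢ (q|wᵢ| - |wᵢ₊₁|)} ≤ ρ^{q|v| - |u|}`; Koblitz, Ch. V §3, p. 130). [cite: Koblitz1984, Ch. V §3] -/
theorem norm_dworkPow_le {q : ℕ} (hq : 1 ≤ q) {s : ℕ} (hs : 0 < s) (v u : ι →₀ ℕ) :
    ‖dworkPow q G s v u‖ ≤ ρ ^ (q * Finsupp.degree v - Finsupp.degree u) := by
  classical
  induction s generalizing v with
  | zero => exact absurd hs (lt_irrefl 0)
  | succ s ih =>
    rcases Nat.eq_zero_or_pos s with rfl | hs'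
    · rw [show (0 : ℕ) + 1 = 1 from rfl, dworkPow_one]
      exact norm_dworkEntry_le hρ0 hG q v u
    · rw [dworkPow_succ]
      simpa only [zero_add] using norm_sum_antidiagonal_le hρ0 hρ1 hG hq 0
        (fun w => dworkPow q G s w u) u v (antidiagonal (q • v)) (subset_refl _)
        (fun x _ => by simpa only [zero_add] using ih hs' x.2)

include hρ0 hρ1 hG in
/-- The same bound for the truncated chain sums: `‖(A_Nˢ)_{v,u}‖ ≤ ρ^{q|v| - |u|}`, `s ≥ 1`. [folklore] -/
theorem norm_dworkPowIn_le (N : ℕ) {q : ℕ} (hq : 1 ≤ q) {s : ℕ} (hs : 0 < s) (v u : ι →₀ ℕ) :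
    ‖dworkPowIn N q G s v u‖ ≤ ρ ^ (q * Finsupp.degree v - Finsupp.degree u) := by
  classical
  induction s generalizing v with
  | zero => exact absurd hs (lt_irrefl 0)
  | succ s ih =>
    rw [dworkPowIn_succ]
    rcases Nat.eq_zero_or_pos s with rfl | hs'
    · -- `s + 1 = 1`: the summand is `g_a δ_{w,u}`
      refine IsUltrametricDist.norm_sum_le_of_forall_le_of_nonneg (pow_nonneg hρ0 _) fun x hx => ?_
      rw [mem_filter, mem_antidiagonal] at hx
      rw [dworkPowIn_zero]
      split_ifs with hxu
      · rw [mul_one]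
        refine (hG _).trans (le_of_eq ?_)
        congr 1
        have hdeg : Finsupp.degree x.1 + Finsupp.degree x.2 = q * Finsupp.degree v := by
          rw [← map_add, hx.1, map_nsmul, smul_eq_mul]
        rw [← hxu]
        omega
      · rw [mul_zero, norm_zero]
        exact pow_nonneg hρ0 _
    · simpa only [zero_add] using norm_sum_antidiagonal_le hρ0 hρ1 hG hq 0
        (fun w => dworkPowIn N q G s w u) u v _
        (filter_subset (fun x : (ι →₀ ℕ) × (ι →₀ ℕ) => Finsupp.degree x.2 ≤ N) _)
        (fun x _ => by simpa only [zero_add] using ih hs' x.2)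

include hρ0 hρ1 hG in
/-- **Chains leaving the truncation are small** (the estimate behind Koblitz's extension of Lemma 4
to infinite matrices, Ch. V §3 p. 131 / §4 Ex. 8): for `|u| ≤ N`, `s ≥ 1`, `q ≥ 1`,
`‖(Aˢ)_{v,u} - (A_Nˢ)_{v,u}‖ ≤ ρ^{(q-1)(N+1) + q|v| - |u|}`, because the difference is the sum over
chains `v → w₁ → ⋯ → u` some of whose nodes `wᵢ` have degree `> N`, and such a chain has weight
of norm `≤ ρ^{(q-1)∑|wᵢ| + |v| - |u|} ≤ ρ^{(q-1)(N+1) + q|v| - |u|}`. [cite: Koblitz1984, Ch. V §3 Lemma 4] -/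
theorem norm_dworkPow_sub_dworkPowIn_le (N : ℕ) {q : ℕ} (hq : 1 ≤ q) {s : ℕ} (hs : 0 < s)
    (v : ι →₀ ℕ) {u : ι →₀ ℕ} (hu : Finsupp.degree u ≤ N) :
    ‖dworkPow q G s v u - dworkPowIn N q G s v u‖ ≤
      ρ ^ ((q - 1) * (N + 1) + q * Finsupp.degree v - Finsupp.degree u) := by
  classical
  induction s generalizing v with
  | zero => exact absurd hs (lt_irrefl 0)
  | succ s ih =>
    rcases Nat.eq_zero_or_pos s with rfl | hs'
    · -- `s + 1 = 1`: no intermediate nodes, the two entries agree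
      have h0 : dworkPow q G 1 v u = dworkPowIn N q G 1 v u := by
        rw [dworkPow_succ, dworkPowIn_succ]
        simp only [dworkPow_zero, dworkPowIn_zero]
        symm
        apply Finset.sum_subset (filter_subset (fun x : (ι →₀ ℕ) × (ι →₀ ℕ) => Finsupp.degree x.2 ≤ N) _)
        intro x hx hxn
        rw [mem_filter, not_and] at hxn
        rw [if_neg, mul_zero]
        rintro rfl
        exact hxn hx hu
      rw [show (0 : ℕ) + 1 = 1 from rfl, h0, sub_self, norm_zero]
      exact pow_nonneg hρ0 _
    · -- split the full sum into the truncated part and the chains whose first node has degree > N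
      have hsplit : dworkPow q G (s + 1) v u - dworkPowIn N q G (s + 1) v u =
          ∑ x ∈ (antidiagonal (q • v)).filter (fun x => Finsupp.degree x.2 ≤ N),
              coeff x.1 G * (dworkPow q G s x.2 u - dworkPowIn N q G s x.2 u) +
            ∑ x ∈ (antidiagonal (q • v)).filter (fun x => ¬Finsupp.degree x.2 ≤ N),
              coeff x.1 G * dworkPow q G s x.2 u := by
        rw [dworkPow_succ, dworkPowIn_succ, ← Finset.sum_filter_add_sum_filter_not (antidiagonal (q • v))
          (fun x => Finsupp.degree x.2 ≤ N)]
        simp only [mul_sub, Finset.sum_sub_distrib]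
        ring
      rw [hsplit]
      refine (IsUltrametricDist.norm_add_le_max _ _).trans (max_le ?_ ?_)
      · -- truncated first node: induction hypothesis
        exact norm_sum_antidiagonal_le hρ0 hρ1 hG hq ((q - 1) * (N + 1))
          (fun w => dworkPow q G s w u - dworkPowIn N q G s w u) u v _
          (filter_subset (fun x : (ι →₀ ℕ) × (ι →₀ ℕ) => Finsupp.degree x.2 ≤ N) _) (fun x _ => ih hs' x.2)
      · -- first node of degree > N
        refine IsUltrametricDist.norm_sum_le_of_forall_le_of_nonneg (pow_nonneg hρ0 _) fun x hx => ?_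
        rw [mem_filter, mem_antidiagonal, not_le] at hx
        have hdeg : Finsupp.degree x.1 + Finsupp.degree x.2 = q * Finsupp.degree v := by
          rw [← map_add, hx.1, map_nsmul, smul_eq_mul]
        rw [norm_mul]
        calc ‖coeff x.1 G‖ * ‖dworkPow q G s x.2 u‖
            ≤ ρ ^ Finsupp.degree x.1 * ρ ^ (q * Finsupp.degree x.2 - Finsupp.degree u) :=
              mul_le_mul (hG _) (norm_dworkPow_le hρ0 hρ1 hG hq hs' x.2 u) (norm_nonneg _)
                (pow_nonneg hρ0 _)
          _ = ρ ^ (Finsupp.degree x.1 + (q * Finsupp.degree x.2 - Finsupp.degree u)) :=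
              (pow_add _ _ _).symm
          _ ≤ _ := by
              apply pow_le_pow_of_le' hρ0 hρ1
              have h2 : (q - 1) * (N + 1) ≤ (q - 1) * Finsupp.degree x.2 :=
                Nat.mul_le_mul_left _ hx.2
              have h3 : (q - 1) * Finsupp.degree x.2 + Finsupp.degree x.2 =
                  q * Finsupp.degree x.2 := by
                rw [Nat.sub_mul, one_mul, Nat.sub_add_cancel (Nat.le_mul_of_pos_left _ hq)]
              omega

include hρ0 hρ1 hG in
/-- **Diagonal form**: `‖(Aˢ)_{v,v} - (A_Nˢ)_{v,v}‖ ≤ ρ^{(q-1)(N+1)}` for `|v| ≤ N`, `s ≥ 1`. [cite: Koblitz1984, Ch. V §3 Lemma 4] -/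
theorem norm_dworkPow_diag_sub_le (N : ℕ) {q : ℕ} (hq : 1 ≤ q) {s : ℕ} (hs : 0 < s)
    {v : ι →₀ ℕ} (hv : Finsupp.degree v ≤ N) :
    ‖dworkPow q G s v v - dworkPowIn N q G s v v‖ ≤ ρ ^ ((q - 1) * (N + 1)) := by
  refine (norm_dworkPow_sub_dworkPowIn_le hρ0 hρ1 hG N hq hs v hv).trans
    (pow_le_pow_of_le' hρ0 hρ1 ?_)
  have : Finsupp.degree v ≤ q * Finsupp.degree v := Nat.le_mul_of_pos_left _ hq
  omega

include hρ0 hρ1 hG in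
/-- **Diagonal decay**: `‖(Aˢ)_{v,v}‖ ≤ ρ^{(q-1)|v|}`, `s ≥ 1` (Koblitz, Ch. V §3, p. 129: "`Tr Ψ =
∑ g_{(q-1)u}`, which clearly converges by the definition of `R₀`"). [cite: Koblitz1984, Ch. V §3] -/
theorem norm_dworkPow_diag_le {q : ℕ} (hq : 1 ≤ q) {s : ℕ} (hs : 0 < s) (v : ι →₀ ℕ) :
    ‖dworkPow q G s v v‖ ≤ ρ ^ ((q - 1) * Finsupp.degree v) := by
  refine (norm_dworkPow_le hρ0 hρ1 hG hq hs v v).trans (le_of_eq ?_)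
  rw [Nat.sub_mul, one_mul]

end Estimates

end Dwork

end Literature.NumberTheory.LFunctions
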